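import Summits.HodgeConjecture.HodgeConjecture.Theorems.F0P2fStubEBPinToAutomorphic -- ★ pin template + J1′ + (D)/(D̄) + carriers
import Summits.HodgeConjecture.HodgeConjecture.Theorems.F0P2aCohFormsContinuous     -- ★ `continuous_apply_of_mem_cohForms_cm`
import Summits.HodgeConjecture.HodgeConjecture.Theorems.F0P3HolProjectionReduction  -- ★ `compactSpace_automorphicQuotient_cm`, `four_le_finrank_of_two_le`
import Literature.NumberTheory.Automorphic.CMFrameHermitian                         -- ★ `transpose_map_cmConjRingHom_eq_of_frame`
import HarnessLib

/-!
# Crux `H413`, programme P2 — B1′: the §1 PACKAGING of the sub-line OCC♭-GEN as a `Theorems/` module (general-frame, GIVEN-MEASURE twin of the pin assembly)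

Cell hodgecm-mathlib (D-0151), FLOOR 0, crux item H413 = stmt-HodgeConjecture-24833; programme P2, socket 27455 `F0HdictE` (road II′), sub-line
`Cruxes/H413/Lines/F0_P2OccFlatGeneral.lean` ED. 1 v2 (d4b61ff8c7817f4a).  Author F0P2-p06 (g8); desk F0P2-plan (g12) PLAN-P2 v13 ERRATUM 3 §E3.2 step 1
(B1′).  `--supports stmt-HodgeConjecture-24833`.  Sorry-free; every step a ★ declaration BY NAME; imports = `Theorems/` + `Literature/` only (no `Lines`).

WHY THIS FILE.  A `Lines` file is never imported.  The ★ cut of E1's `stub_occFlatAll` (E3.2 steps 2–4) needs the line's §1 — the packaging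
`cmFieldOf` ∕ `hermSpace3Of` ∕ `archFactorOfFrame` and the general-frame, GIVEN-MEASURE twin **`exists_cotangentType_hasFinComponent_of_occursIn_cm`** of ★
`F0P2fStubEBPinToAutomorphic.exists_cotangentType_hasFinComponent_of_occursIn` — importable from `Theorems/`.  This module is that §1, statements and proofs
token for token (only the namespace differs), so `Theorems/F0P2OccFlatAllHolds.lean` can be `import`-built over it and the ★ letter the day Θ-OCC-GEN lands.

THE CONTENT (= the line's §1 docstring).  For a CM frame `(L, ι, H, T)` with `T^H·H^ι·T = J` (signature `(2,1)` at `ι`), `H` definite off `ι` (`hpos`) and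
`[L⁺:ℚ] ≥ 2`: package `F := ⟨L⟩ : HodgeCM.CMField`, `V := ⟨H, hermitian (★ `transpose_map_cmConjRingHom_eq_of_frame`), ⟨T, hT⟩, hpos⟩ : HodgeCM.HermSpace3 F ι`,
`𝔞 := ⟨cmArchSection, cmCompactFactor⟩ : ArchFactor F V`; then `adelicDatum F V = adelicGroupData L⁺ L c̄ 3 H` and `cohForms 𝔞 = CotangentForms.cohForms …
(cmArchSection …) (cmCompactFactor …)` by `rfl`, and for the GIVEN automorphic measure `μ`, an irreducible `σ` of `U(H)(𝔸_{L⁺,f})` and a NON-ZERO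
`σ`-equivariant `θ` into `cohForms`, some discrete automorphic `P ≤ L²(μ)` is (anti)holomorphic-cotangent at `(cmArchSection, cmCompactFactor)` with
`P.HasFinComponent σ` (J1′ ★ `exists_discreteAutomorphicRep_of_equivariant_cohForms` + (D) ★ `holCotFormSpectralProjection_holds` ∕ (D̄) ★
`antiholCotFormSpectralProjection_of_hol` + ★ `exists_ne_zero_containsForm_of_classes` + ★ `orthogonalProjectionOnto_ne_zero`; compactness ★
`compactSpace_automorphicQuotient_cm`, continuity ★ `continuous_apply_of_mem_cohForms_cm`).
HC_CM is proved only modulo the 2 remaining named inputs (hLiu418, h413) until rung 0 closes; this file discharges no printed citation.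

## References
* [Liu2021] Y. Liu, Camb. J. Math. 9 (2021) = arXiv:2102.11518: proof of Prop. 4.13 (l. 2131–2146).
* [BorelJacquet1979] A. Borel, H. Jacquet, PSPM 33.1 (1979): §4.1, §4.2, §4.6.  [Borel1997] A. Borel, CUP 1997: Thm. 2.13, §8.4.
* [BorelWallach2000] A. Borel, N. Wallach, 2nd ed. (2000): VII 2.10.  [PlatonovRapinchuk1994] V. Platonov, A. Rapinchuk (1994): §5.1.
-/

set_option autoImplicit false
set_option linter.dupNamespace false

noncomputable section

namespace Summit.HodgeConjecture.HodgeConjecture.Cruxes.H413.F0P2OccGenCotangentOfOccursIn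

open scoped TensorProduct Matrix InnerProductSpace ENNReal ComplexOrder
open MeasureTheory
open NumberField NumberField.InfinitePlace IsDedekindDomain
open Literature.AlgebraicGeometry.ShimuraVarieties
open Literature.NumberTheory Literature.NumberTheory.Automorphic Literature.NumberTheory.Automorphic.UnitaryGroup
open Literature.NumberTheory.Automorphic.UnitaryGroup.CotangentForms (toQuotFun cmArchSection cmCompactFactor cohForms_le_smoothFun
  isSmooth_of_equivariant_of_le_smoothFun holCotFormSpectralProjection antiholCotFormSpectralProjection antiholCotFormSpectralProjection_of_hol)
open Literature.NumberTheory.Automorphic.Liu2021 Literature.NumberTheory.Automorphic.Liu2021.AppendixC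
open Literature.NumberTheory.Automorphic.Liu2021.Def411WeilCarriers
open Literature.NumberTheory.Automorphic.Liu2021.Def411WeilCarriersDoubling
open Literature.NumberTheory.Automorphic.IdeleClassGroup
open Literature.NumberTheory.GelbartRogawski1991 Literature.NumberTheory.GelbartRogawski1991.UnitaryDualPair
open Literature.NumberTheory.GelbartRogawski1991.UnitaryDualPair.WeilCoinv
open Literature.RepresentationTheory Literature.RepresentationTheory.Liu2021
open Literature.NumberTheory.Rogawski1990
open Literature.NumberTheory.QuadraticForms
open Literature.AlgebraicGeometry.Liu2021 (IsAdmissibleElement exists_isAdmissibleElement_of_cmType)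
open Summit.HodgeConjecture.CorCM
open Summit.HodgeConjecture.CorCM.Transposition
open Summit.HodgeConjecture.HodgeConjecture.Cruxes.H413.CohFormsCarriers
open Summit.HodgeConjecture.HodgeConjecture.Cruxes.H413.F0P3SpectralJunction
open Summit.HodgeConjecture.HodgeConjecture.Cruxes.H413.F0P3StubS5Fold (two_le_finrank_maximalRealSubfield exists_ne_zero_containsForm_of_classes)
open Summit.HodgeConjecture.HodgeConjecture.Cruxes.H413.F0P3HilbertProjection (orthogonalProjectionOnto_ne_zero)
open Summit.HodgeConjecture.HodgeConjecture.Cruxes.H413.SpectrumJunction (continuous_toQuotFun cohForms_eq_generic compactSpace_automorphicQuotient_adelicDatum)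
open Summit.HodgeConjecture.HodgeConjecture.Cruxes.H413.SpectrumInterfaces
open Summit.HodgeConjecture.HodgeConjecture.Cruxes.H413.F0P2dSocketD (holCotFormSpectralProjection_holds)
open Summit.HodgeConjecture.HodgeConjecture.Cruxes.H413.F0P2aCohFormsContinuous (continuous_apply_of_mem_cohForms_cm)
open Summit.HodgeConjecture.HodgeConjecture.Cruxes.H413.F0P3HolProjectionReduction (compactSpace_automorphicQuotient_cm four_le_finrank_of_two_le)
open Summit.HodgeConjecture.HodgeConjecture.Cruxes.H413.F0P2fStubEBPinToAutomorphic (nontrivial_of_linearMap_ne_zero)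

/-! ## §1 Packaging of a CM frame as pin data; the general-frame, GIVEN-MEASURE twin of the pin assembly (sorry-free, all ★ by name) -/

variable (L : Type) [Field L] [NumberField L] [IsCMField L] (ι : L →+* ℂ) (H : Matrix (Fin 3) (Fin 3) L) (T : GL (Fin 3) ℂ)
  (hT : (T : Matrix (Fin 3) (Fin 3) ℂ)ᴴ * H.map ι * (T : Matrix (Fin 3) (Fin 3) ℂ) = Literature.Geometry.ComplexHyperbolic.BallModel.J)
  (hpos : ∀ τ' : L →+* ℂ, InfinitePlace.mk τ' ≠ InfinitePlace.mk ι → (H.map τ').PosDef)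

/-- PACKAGING 1: `L` as a bundled `HodgeCM.CMField`. [cite: PlatonovRapinchuk1994, §5.1] -/
abbrev cmFieldOf : HodgeCM.CMField := HodgeCM.CMField.mk L

/-- PACKAGING 2: `(H, T)` as a `HodgeCM.HermSpace3` over the packaged field at `ι` (hermitian by ★ `transpose_map_cmConjRingHom_eq_of_frame`,
signature `(2,1)` at `ι` by the frame itself, definite elsewhere by `hpos`). [cite: PlatonovRapinchuk1994, §5.1] -/
abbrev hermSpace3Of : HodgeCM.HermSpace3 (cmFieldOf L) ι where
  Hm := H
  isHermitian i j := by
    have h := congrFun (congrFun (transpose_map_cmConjRingHom_eq_of_frame L ι H T hT) j) i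
    have h' : cmConjRingHom L (H i j) = H j i := by simpa [Matrix.transpose_apply, Matrix.map_apply] using h
    -- `conjRingHomK` and `cmConjRingHom` are both `(IsCMField.complexConj L).toRingEquiv.toRingHom` (delta)
    exact h'
  signature_ι₁ := ⟨T, by rw [UnitaryBallUniformisationDatum.signatureMatrix_two]; exact hT⟩
  posDef_of_ne := hpos

/-- PACKAGING 3: the frame's archimedean factor `(cmArchSection, cmCompactFactor)` as an `ArchFactor` of the packaged data. [cite: BorelJacquet1979, §4.1] -/
abbrev archFactorOfFrame : ArchFactor (cmFieldOf L) (hermSpace3Of L ι H T hT hpos) :=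
  ⟨cmArchSection L ι H T hT, cmCompactFactor L ι H T hT⟩

/-- the packaged adelic datum IS the frame's `adelicGroupData` (`rfl`). [cite: BorelJacquet1979, §4.1] -/
example : adelicDatum (cmFieldOf L) (hermSpace3Of L ι H T hT hpos) =
    adelicGroupData (↥(maximalRealSubfield L)) L (IsCMField.complexConj L) 3 H := rfl

/-- the packaged `cohForms` IS the generic `cohForms` of the frame (`rfl`). [cite: BorelWallach2000, VII 2.10] -/
example : cohForms (archFactorOfFrame L ι H T hT hpos) =
    CotangentForms.cohForms (↥(maximalRealSubfield L)) L (IsCMField.complexConj L) 3 H (cmArchSection L ι H T hT) (cmCompactFactor L ι H T hT) := rfl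

set_option synthInstance.maxHeartbeats 400000 in
set_option maxHeartbeats 8000000 in
/-- **GENERAL-FRAME, GIVEN-MEASURE twin of ★ `exists_cotangentType_hasFinComponent_of_occursIn`.**  For a CM frame `(L, ι, H, T)` with `H`
definite off `ι` and `[L⁺:ℚ] ≥ 2`, an automorphic measure `μ` on `U(H)(L⁺)\U(H)(𝔸_{L⁺})`, an irreducible `σ` of `U(H)(𝔸_{L⁺,f})` and a NON-ZERO
`σ`-equivariant linear map `θ` into the cohomological cotangent forms of the frame: some discrete automorphic `P ≤ L²(μ)` is of holomorphic or
antiholomorphic cotangent type at `(cmArchSection, cmCompactFactor)` and has finite component `σ`.  Proof = the pin proof with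
`(F, V, 𝔞) :=` the packaging and step 2 (choice of a measure) deleted.
[cite: BorelJacquet1979, §4.2, §4.6] [cite: Borel1997, Thm. 2.13, §8.4] [cite: Liu2021, proof of Prop. 4.13 l. 2131–2146] -/
theorem exists_cotangentType_hasFinComponent_of_occursIn_cm (h2 : 2 ≤ Module.finrank ℚ ↥(maximalRealSubfield L))
    (μ : Measure (adelicGroupData (↥(maximalRealSubfield L)) L (IsCMField.complexConj L) 3 H).automorphicQuotient)
    [(adelicGroupData (↥(maximalRealSubfield L)) L (IsCMField.complexConj L) 3 H).IsAutomorphicMeasure μ]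
    {W : Type} [AddCommGroup W] [Module ℂ W]
    (σ : Representation ℂ ↥(finAdelic (↥(maximalRealSubfield L)) L (IsCMField.complexConj L) 3 H) W) (hirr : σ.IsIrreducible)
    (θ : W →ₗ[ℂ] ((adelicGroupData (↥(maximalRealSubfield L)) L (IsCMField.complexConj L) 3 H).Adelic → (Fin 2 → ℂ))) (hθ0 : θ ≠ 0)
    (hθA : ∀ w, θ w ∈ CotangentForms.cohForms (↥(maximalRealSubfield L)) L (IsCMField.complexConj L) 3 H
      (cmArchSection L ι H T hT) (cmCompactFactor L ι H T hT))
    (hθσ : ∀ (g : ↥(finAdelic (↥(maximalRealSubfield L)) L (IsCMField.complexConj L) 3 H)) (w : W),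
      θ (σ g w) = rightRep (cmFieldOf L) (hermSpace3Of L ι H T hT hpos) g (θ w)) :
    ∃ P : DiscreteAutomorphicRep (adelicGroupData (↥(maximalRealSubfield L)) L (IsCMField.complexConj L) 3 H) μ,
      (P.IsHolCotangentAt (cmArchSection L ι H T hT) (cmCompactFactor L ι H T hT) ∨
          P.IsAntiholCotangentAt (cmArchSection L ι H T hT) (cmCompactFactor L ι H T hT)) ∧
        P.HasFinComponent σ := by
  have h4 : 4 ≤ Module.finrank ℚ L := four_le_finrank_of_two_le h2
  have hD : holCotFormSpectralProjection := holCotFormSpectralProjection_holds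
  have hD' : antiholCotFormSpectralProjection := antiholCotFormSpectralProjection_of_hol hD
  haveI : CompactSpace (adelicGroupData (↥(maximalRealSubfield L)) L (IsCMField.complexConj L) 3 H).automorphicQuotient :=
    compactSpace_automorphicQuotient_cm hpos h2
  have hcont : ∀ f ∈ cohForms (archFactorOfFrame L ι H T hT hpos), ∀ j : Fin 2, Continuous fun x => f x j :=
    fun f hf j => continuous_apply_of_mem_cohForms_cm L ι H T hT hf j
  -- step 3: J1′ at the packaged carriers, AT THE GIVEN MEASURE
  obtain ⟨P, w, j, h, hu, hfin⟩ := exists_discreteAutomorphicRep_of_equivariant_cohForms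
    (F := cmFieldOf L) (V := hermSpace3Of L ι H T hT hpos) h4 μ (archFactorOfFrame L ι H T hT hpos) hcont σ hirr θ hθσ hθA hθ0
  have hmem : ∀ f ∈ cohForms (archFactorOfFrame L ι H T hT hpos), ∀ j : Fin 2,
      MemLp (toQuotFun (adelicGroupData (↥(maximalRealSubfield L)) L (IsCMField.complexConj L) 3 H) fun x => f x j) 2 μ :=
    fun f hf j => memLp_of_continuous (continuous_toQuotFun (cohForms_left_invariant_apply (archFactorOfFrame L ι H T hT hpos) hf j) (hcont f hf j))
  -- step 4: split the value `θ w` along `cohForms = holCotForms ⊔ conj holCotForms`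
  obtain ⟨A, hA, B, hB', hAB⟩ := Submodule.mem_sup.mp (hθA w)
  have hAc : A ∈ cohForms (archFactorOfFrame L ι H T hT hpos) := Submodule.mem_sup_left hA
  have hBc : B ∈ cohForms (archFactorOfFrame L ι H T hT hpos) := Submodule.mem_sup_right hB'
  have hsum : h.toLp (toQuotFun (adelicGroupData (↥(maximalRealSubfield L)) L (IsCMField.complexConj L) 3 H) fun x => θ w x j) =
      (hmem A hAc j).toLp (toQuotFun (adelicGroupData (↥(maximalRealSubfield L)) L (IsCMField.complexConj L) 3 H) fun x => A x j) +
        (hmem B hBc j).toLp (toQuotFun (adelicGroupData (↥(maximalRealSubfield L)) L (IsCMField.complexConj L) 3 H) fun x => B x j) := by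
    rw [← MemLp.toLp_add]
    exact MemLp.toLp_congr _ _ (Filter.EventuallyEq.of_eq (funext fun y => by simp only [toQuotFun, ← hAB, Pi.add_apply]))
  obtain ⟨u, huP, hne⟩ := hu
  have hsplit : ⟪(u : (adelicGroupData (↥(maximalRealSubfield L)) L (IsCMField.complexConj L) 3 H).L2 μ),
        (hmem A hAc j).toLp (toQuotFun (adelicGroupData (↥(maximalRealSubfield L)) L (IsCMField.complexConj L) 3 H) fun x => A x j)⟫_ℂ ≠ 0 ∨
      ⟪(u : (adelicGroupData (↥(maximalRealSubfield L)) L (IsCMField.complexConj L) 3 H).L2 μ),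
        (hmem B hBc j).toLp (toQuotFun (adelicGroupData (↥(maximalRealSubfield L)) L (IsCMField.complexConj L) 3 H) fun x => B x j)⟫_ℂ ≠ 0 := by
    by_contra hcon
    push Not at hcon
    apply hne
    rw [hsum, inner_add_right, hcon.1, hcon.2, add_zero]
  have htype : P.IsHolCotangentAt (cmArchSection L ι H T hT) (cmCompactFactor L ι H T hT) ∨
      P.IsAntiholCotangentAt (cmArchSection L ι H T hT) (cmCompactFactor L ι H T hT) := by
    rcases hsplit with hA1 | hB1
    · left
      obtain ⟨Ψ, hΨ, hΨ', heq⟩ := hD L ι H T hT hpos h2 μ P A hA (hmem A hAc)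
      refine exists_ne_zero_containsForm_of_classes P hΨ hΨ' (fun j' => ?_) ⟨j, ?_⟩
      · rw [← heq j']
        exact Submodule.starProjection_apply_mem _ _
      · rw [← heq j, Submodule.starProjection_apply]
        exact Subtype.coe_ne_coe.mpr (orthogonalProjectionOnto_ne_zero P.space ⟨u, huP, hA1⟩)
    · right
      obtain ⟨Ψ, hΨ, hΨ', heq⟩ := hD' L ι H T hT hpos h2 μ P B hB' (hmem B hBc)
      refine exists_ne_zero_containsForm_of_classes P hΨ hΨ' (fun j' => ?_) ⟨j, ?_⟩
      · rw [← heq j']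
        exact Submodule.starProjection_apply_mem _ _
      · rw [← heq j, Submodule.starProjection_apply]
        exact Subtype.coe_ne_coe.mpr (orthogonalProjectionOnto_ne_zero P.space ⟨u, huP, hB1⟩)
  exact ⟨P, htype, hfin⟩

end Summit.HodgeConjecture.HodgeConjecture.Cruxes.H413.F0P2OccGenCotangentOfOccursIn

end
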